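import Literature.NumberTheory.EllipticCurves.ZpExtensionEisensteinGradedInvariantsVanishingProofs
import Literature.NumberTheory.EllipticCurves.ZpExtensionEisensteinTwistFixedPointBoundProofs
import Literature.NumberTheory.EllipticCurves.IwasawaAlgebraEisensteinUniformIndexProofs
import Literature.NumberTheory.GaloisRepresentations.OneCocycleRestrictionKernelCountProofs
import Literature.NumberTheory.EllipticCurves.TorsionFilAtAdaptedBasisProofs
import Literature.NumberTheory.EllipticCurves.ZpExtensionEisensteinOrdinaryFiltration
import HarnessLib

/-!
# `#H⁰(K_w, W_k / Fil_w W_k) ≤ p^{p^s}` UNIFORMLY in the level `k` and in `m`, and the count of local classes of the graded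
# piece dying over `K_{∞,w}` (theorems only; no definition, no named fact, no instance, no `sorry`)

Topic `NumberTheory/EllipticCurves` (cell `pub/bsd-print-x9`, shared μ-crux stmt-BirchSwinnertonDyer-23428, STUB B clause (B5)
`Stmt.readoutIndex` = the `m`-UNIFORM index of Howard's readout; blueprint `HOME/p2/S1-DISCRETE-CONTROL` §2 «v ∣ p»: the local
defect between «Kummer/strict condition over `K_{∞,w}`» and «ordinary core over `K_v`» injects into
`ker (H¹(K_w, gr_w T^{(k)}) → H¹(K_{∞,w}, gr_w T^{(k)}))`, whose order is `≤ #H⁰(K_w, gr_w T^{(k)})` by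
`OneCocycleRestrictionKernelCountProofs`).  Sequel of `ZpExtensionEisensteinGradedInvariantsVanishingProofs` (the
NON-anomalous case: no invariants); here the GENERAL (anomalous allowed) case: a BOUND.

For the Eisenstein tower `W_k = M_k ⊗ A_{m,k}(ψ)` of any tower `(M_k, t_k)` of discrete `Γ_K`-modules with an ordinary datum `Φ`
at a finite place `w` (`Fil_w W_k = A_{m,k} ⊗ Fil_w M_k`, `OrdinaryFiltration.twistedFil`) and an element `σ₀ ∈ Γ_{K_w}` acting on
the graded piece `gr_w M_k = M_k / Fil_w M_k` as an integer `n₀` (automatic when `gr_w M_k` is cyclic, e.g. `M_k = E[p^k]` at a place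
of good ordinary reduction):

* §0 **`EisensteinCoeff.natCard_quotient_span_intCast_mul_onePlusT_pow_sub_one_le`** — if `p ∤ n₀` and `p^s < m` then
  `#(A_{m,k} ⧸ (n₀(1+T)^{p^s} − 1)) ≤ p^{p^s}` for EVERY `k` (the element lifts to `C n₀ · (1+X)^{p^s} − 1 ∈ Λ`, whose coefficient in
  degree `p^s < m` is the unit `n₀`: `natCard_quotient_span_mk_le_of_isUnit_coeff` through `A_{m,k} ↞ S_m`).
* §1 `OrdinaryFiltration.toLocal_apply_sub_smul_mem_twistedFil` — `σ₀` acts on `W_k` as the SCALAR `μ = n₀ (1+T)^{κ(σ₀)}` modulo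
  `Fil_w W_k` (the level-`k` form of x10b-p1-w8's level-`1` lemma `toLocal_apply_sub_sub_smul_mem_twistedFil_one`).
* §2 `exists_sub_smul_tmul_mem_twistedFil` — if `M_k = ℤ Q₀ + Fil_w M_k` then `W_k = A_{m,k}·(1 ⊗ Q₀) + Fil_w W_k`: the graded
  piece `gr_w W_k` is a CYCLIC `A_{m,k}`-line.
* §3 `natCard_setOf_quotient_twistedFil_apply_eq_self_le` — `#{q ∈ W_k / Fil_w W_k | σ₀ q = q} ≤ #(A_{m,k} ⧸ (μ − 1))`
  (`OneCocycleRestrictionKernelCountProofs.natCard_setOf_quotient_apply_eq_self_le`), hence the same for the `Γ_{K_w}`-invariants,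
  and with §0 **`natCard_setOf_quotient_twistedFil_forall_apply_eq_self_le_pow`**: `#H⁰(K_w, W_k / Fil_w W_k) ≤ p^{p^s}` when
  `κ(σ₀) = p^s < m`, `p ∤ n₀` — uniformly in `k` and `m`.
* §5 **`finite_and_natCard_setOf_oneCocycleClass_quotient_twistedFil_principal_le_pow`** — with `S := {σ ∈ Γ_{K_w} | res σ ∈ ker κ}`
  (`= Gal(K̄_w/K_{∞,w'})`): the classes of `H¹(K_w, W_k / Fil_w W_k)` that are PRINCIPAL ON `S` form a finite set of order
  `≤ p^{p^s}` (`OneCocycleRestrictionKernelCountProofs`: `#ker(res) ≤ #H⁰` for the dense `⟨S, g₀⟩` of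
  `exists_dense_closure_ker_union_singleton` applied to `κ ∘ res : Γ_{K_w} → ℤ_p`), for every `k` and every `m > p^s`.
* §6 (pure algebra) an automorphism and its inverse preserving the kernel of a coordinate `π : N → ℤ/p^k` with `π Q₀ = 1` act as
  an integer `n₀` PRIME TO `p` modulo `ker π`, and `N = ℤ Q₀ + ker π`.
* §7 **`WeierstrassCurve.finite_and_natCard_setOf_oneCocycleClass_quotient_torsionFilAt_principal_le_pow`** — the `E[p^k]`-instance
  (`k ≥ 1`): at a place `v ∋ p` of good reduction with an ordinary point (`exists_addEquiv_mem_torsionFilAt_iff` gives the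
  coordinate), for ANY `σ₀ ∈ Γ_{K_v}` with `κ(σ₀) = p^s`, `p^s < m`, the classes of `H¹(K_v, T/Fil_v T)`,
  `T = E[p^k] ⊗ A_{m,k}(ψ)`, principal on `Gal(K̄_v/K_{∞,w})` number `≤ p^{p^s}` — the `m`-UNIFORM local input of (B5) at
  `v ∣ p`, graded half (the other half, `H¹(K_v, Fil_v A_𝔮)` modulo its divisible part, is `#H²(K_v, Fil_v T_𝔮)`-sized).

No summit statement is proved; BSD is not proved by any of this.

References: [Howard2004HeegnerKolyvagin] B. Howard, Compositio Math. 140 (2004), Lemma 3.2.7 (arXiv:1202.6340 p. 16 L150–158,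
p. 17 L14–29: the correction terms `H⁰(K_v, gr_v ·)`), §3.1, Prop. 2.2.8 and proof of Thm. 2.2.10 (`𝔮 = T^m + p`, `m`-uniformity);
[GreenbergLNM1716] R. Greenberg, LNM 1716 (1999), §2–§3 (ordinary filtration, anomalous primes, local kernels up the tower);
[SerreGaloisCohomology1997] I §2.6(b), and Local Fields XIII §1; [Washington1997] §7.1 (`Λ`, distinguished polynomials).
-/

set_option autoImplicit false

noncomputable section

open Function NumberField IsDedekindDomain Field
open scoped NumberField TensorProduct ContRepresentation

namespace Literature.NumberTheory.EllipticCurves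

open Literature.NumberTheory.GaloisRepresentations IwasawaAlgebra IwasawaAlgebra.EisensteinCoeff


/-! ## §0 `#(A_{m,k} ⧸ (n₀(1+T)^{p^s} − 1)) ≤ p^{p^s}` for every `k`, when `p ∤ n₀` and `p^s < m` -/

namespace IwasawaAlgebra.EisensteinCoeff

variable (p : ℕ) [hp : Fact p.Prime] {m : ℕ}

/-- The degree-`p^s` coefficient of `C n₀ · (1+X)^{p^s} − 1 ∈ Λ` is `n₀` (`s` arbitrary: `p^s ≥ 1`).
[cite: Washington1997, §7.1 (polynomials in Λ)] -/
theorem coeff_C_mul_onePlusX_pow_sub_one (n₀ : ℤ_[p]) (s : ℕ) :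
    PowerSeries.coeff (p ^ s) (PowerSeries.C n₀ * ((1 : IwasawaAlgebra p) + PowerSeries.X) ^ (p ^ s) - 1) = n₀ := by
  have hps : p ^ s ≠ 0 := pow_ne_zero _ hp.out.ne_zero
  rw [map_sub, PowerSeries.coeff_C_mul, coeff_one_add_X_pow, Nat.choose_self, Nat.cast_one, mul_one,
    PowerSeries.coeff_one, if_neg hps, sub_zero]

/-- **`#(A_{m,k} ⧸ (n₀(1+T)^{p^s} − 1)) ≤ p^{p^s}`, uniformly in `k` (and in `m > p^s`)**, for `n₀ ∈ ℤ_p^×`: the element lifts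
to `F = C n₀ · (1+X)^{p^s} − 1 ∈ Λ` with UNIT coefficient in degree `p^s < m`, so `#(S_m ⧸ (F̄)) ≤ p^{p^s}`
(`natCard_quotient_span_mk_le_of_isUnit_coeff`, Weierstrass preparation) and `A_{m,k} ⧸ (F̄)` is a quotient of `S_m ⧸ (F̄)`.
This is the size of the coinvariants / invariants of an element `g₁` with `κ(g₁) = p^s` acting by `n₀` on a cyclic
`A_{m,k}`-line — Howard's `H⁰(K_v, gr_v ·)` correction at `𝔮 = T^m + p`, bounded INDEPENDENTLY of `m`.
[cite: Howard2004HeegnerKolyvagin, Lemma 3.2.7 and proof of Thm. 2.2.10 (𝔮 = T^m + p)] [cite: Washington1997, §7.1 Thm. 7.3] -/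
theorem natCard_quotient_span_C_mul_onePlusT_pow_sub_one_le (hm : 1 ≤ m) (k : ℕ) {n₀ : ℤ_[p]} (hn₀ : IsUnit n₀)
    {s : ℕ} (hms : p ^ s < m) :
    Finite (EisensteinCoeff p m k ⧸
        Ideal.span {algebraMap ℤ_[p] (EisensteinCoeff p m k) n₀ * onePlusT p m k ^ (p ^ s) - 1}) ∧
      Nat.card (EisensteinCoeff p m k ⧸
          Ideal.span {algebraMap ℤ_[p] (EisensteinCoeff p m k) n₀ * onePlusT p m k ^ (p ^ s) - 1}) ≤ p ^ (p ^ s) := by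
  set F : IwasawaAlgebra p := PowerSeries.C n₀ * ((1 : IwasawaAlgebra p) + PowerSeries.X) ^ (p ^ s) - 1 with hF
  have hu : IsUnit (PowerSeries.coeff (p ^ s) F) := by
    rw [hF, coeff_C_mul_onePlusX_pow_sub_one]; exact hn₀
  haveI := finite_quotient_span_mk_of_isUnit_coeff p hm hms hu
  haveI : Finite (EisensteinCoeff p m k) := finite_quotient_span_qm_sup_span_C_pow p hm k
  -- the element is the image of `F`
  set π : IwasawaAlgebra p →+* EisensteinCoeff p m k := Ideal.Quotient.mk _ with hπ
  have hC : π (PowerSeries.C n₀) = algebraMap ℤ_[p] (EisensteinCoeff p m k) n₀ := by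
    rw [hπ, ← Ideal.Quotient.mk_comp_algebraMap, RingHom.comp_apply]
    rfl
  have hX : π ((1 : IwasawaAlgebra p) + PowerSeries.X) = onePlusT p m k := rfl
  have hmk : ofSpec p m k (Ideal.Quotient.mk _ F) =
      algebraMap ℤ_[p] (EisensteinCoeff p m k) n₀ * onePlusT p m k ^ (p ^ s) - 1 := by
    rw [ofSpec_mk]
    change π F = _
    rw [hF, map_sub π, map_mul π, map_pow π, map_one π, hC, hX]
  rw [← hmk]
  exact ⟨Finite.of_surjective _ Ideal.Quotient.mk_surjective,
    (Literature.Algebra.Module.natCard_quotient_span_map_le _ (ofSpec_surjective (p := p) m k) _).trans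
      (natCard_quotient_span_mk_le_of_isUnit_coeff p hms hu)⟩

/-- The same with an INTEGER `n₀` prime to `p` (`(n₀ : A_{m,k}) = algebraMap ℤ_p A_{m,k} n₀`).
[cite: Howard2004HeegnerKolyvagin, Lemma 3.2.7 and proof of Thm. 2.2.10] -/
theorem natCard_quotient_span_intCast_mul_onePlusT_pow_sub_one_le (hm : 1 ≤ m) (k : ℕ) {n₀ : ℤ}
    (hn₀ : ¬ (p : ℤ) ∣ n₀) {s : ℕ} (hms : p ^ s < m) :
    Finite (EisensteinCoeff p m k ⧸ Ideal.span {(n₀ : EisensteinCoeff p m k) * onePlusT p m k ^ (p ^ s) - 1}) ∧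
      Nat.card (EisensteinCoeff p m k ⧸ Ideal.span {(n₀ : EisensteinCoeff p m k) * onePlusT p m k ^ (p ^ s) - 1}) ≤
        p ^ (p ^ s) := by
  have hunit : IsUnit ((n₀ : ℤ_[p])) := by
    rw [PadicInt.isUnit_iff]
    exact le_antisymm (PadicInt.norm_le_one _) (not_lt.1 fun h ↦ hn₀ (PadicInt.norm_int_lt_one_iff_dvd n₀ |>.1 h))
  have hcast : (n₀ : EisensteinCoeff p m k) = algebraMap ℤ_[p] (EisensteinCoeff p m k) (n₀ : ℤ_[p]) := by
    rw [map_intCast]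
  rw [hcast]
  exact natCard_quotient_span_C_mul_onePlusT_pow_sub_one_le p hm k hunit hms

end IwasawaAlgebra.EisensteinCoeff


namespace ZpExtension

variable {K : Type} [Field K] [NumberField K] {p : ℕ} [hp : Fact p.Prime] (κ : ZpExtension K p)
  {M : ℕ → Type} [∀ k, AddCommGroup (M k)] [∀ k, TopologicalSpace (M k)] [∀ k, DiscreteTopology (M k)]
  {ρ : ∀ k, DiscreteGaloisModule K (M k)}
  {t : ∀ k, (ρ (k + 1)).toContRepresentation →ⁱL (ρ k).toContRepresentation} {m : ℕ} (hm : 1 ≤ m)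
  {w : HeightOneSpectrum (𝓞 K)} (Φ : OrdinaryFiltration ρ t w)

namespace OrdinaryFiltration

/-! ## §1 `σ₀` acts on `W_k` as a scalar modulo `Fil_w W_k` -/

/-- **`σ₀` acts on `W_k = M_k ⊗ A_{m,k}(ψ)` as the scalar `μ = n₀ (1+T)^{κ(σ₀)}` MODULO `Fil_w W_k`**, if `σ₀ ∈ Γ_{K_w}` acts on `M_k` as the
integer `n₀` modulo `Fil_w M_k`: on a pure tensor `σ₀ (c ⊗ a) − μ (c ⊗ a) = ((1+T)^e c) ⊗ (σ₀ a − n₀ a) ∈ A ⊗ Fil`.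
(Level-`k` form of `toLocal_apply_sub_sub_smul_mem_twistedFil_one`.)
[cite: Howard2004HeegnerKolyvagin, §2.2 and §3.1 (arXiv:1202.6340 p. 15: the action on T_𝔮 = T ⊗ S_𝔮(ψ), gr_v)] -/
theorem toLocal_apply_sub_smul_mem_twistedFil (k : ℕ) (σ₀ : absoluteGaloisGroup (w.adicCompletion K)) (n₀ : ℤ)
    (hσ₀ : ∀ a : M k, GaloisRep.toLocal w (ρ k) σ₀ a - n₀ • a ∈ Φ.fil k)
    (x : EisensteinCoeff.Twisted p m k (M k)) :
    GaloisRep.toLocal w (κ.eisensteinTwist (ρ k) hm k) σ₀ x -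
        ((n₀ : EisensteinCoeff p m k) * EisensteinCoeff.onePlusT p m k ^
            κ.twistExponent (eisensteinLevel (p := p) hm k) (absGaloisRestrict K (w.adicCompletion K) σ₀)) • x ∈
      Φ.twistedFil k := by
  set ue : EisensteinCoeff p m k := EisensteinCoeff.onePlusT p m k ^
    κ.twistExponent (eisensteinLevel (p := p) hm k) (absGaloisRestrict K (w.adicCompletion K) σ₀) with hue
  induction x using EisensteinCoeff.Twisted.induction_on with
  | zero => rw [map_zero, smul_zero, sub_zero]; exact zero_mem _
  | tmul c a =>
    rw [GaloisRep.toLocal_apply, κ.eisensteinTwist_apply_tmul (ρ k) hm k, EisensteinCoeff.Twisted.smul_tmul]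
    -- additivity of `tmul` in the second argument
    let φ : M k →+ EisensteinCoeff.Twisted p m k (M k) :=
      { toFun := fun b ↦ EisensteinCoeff.Twisted.tmul (ue * c) b
        map_zero' := TensorProduct.tmul_zero _ _
        map_add' := fun b b' ↦ TensorProduct.tmul_add _ _ _ }
    -- `σ₀ a = n₀ a + f₀`, `f₀ ∈ Fil`
    have hdecomp : ρ k (absGaloisRestrict K (w.adicCompletion K) σ₀) a =
        n₀ • a + (GaloisRep.toLocal w (ρ k) σ₀ a - n₀ • a) := by
      rw [GaloisRep.toLocal_apply, add_sub_cancel]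
    have h1 : EisensteinCoeff.Twisted.tmul (p := p) (m := m) (k := k) (ue * c)
          (ρ k (absGaloisRestrict K (w.adicCompletion K) σ₀) a) =
        EisensteinCoeff.Twisted.tmul ((n₀ : EisensteinCoeff p m k) * (ue * c)) a +
          EisensteinCoeff.Twisted.tmul (ue * c) (GaloisRep.toLocal w (ρ k) σ₀ a - n₀ • a) := by
      change φ (ρ k (absGaloisRestrict K (w.adicCompletion K) σ₀) a) = _
      rw [hdecomp, map_add, map_zsmul]
      change n₀ • EisensteinCoeff.Twisted.tmul (ue * c) a + EisensteinCoeff.Twisted.tmul (ue * c) _ = _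
      rw [← Int.cast_smul_eq_zsmul (EisensteinCoeff p m k) n₀, EisensteinCoeff.Twisted.smul_tmul]
    rw [h1, show (n₀ : EisensteinCoeff p m k) * ue * c = (n₀ : EisensteinCoeff p m k) * (ue * c) by ring,
      add_sub_cancel_left]
    exact Φ.tmul_mem_twistedFil k _ (hσ₀ a)
  | add x y hx hy =>
    have heq : GaloisRep.toLocal w (κ.eisensteinTwist (ρ k) hm k) σ₀ (x + y) -
        ((n₀ : EisensteinCoeff p m k) * ue) • (x + y) =
        (GaloisRep.toLocal w (κ.eisensteinTwist (ρ k) hm k) σ₀ x - ((n₀ : EisensteinCoeff p m k) * ue) • x) +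
          (GaloisRep.toLocal w (κ.eisensteinTwist (ρ k) hm k) σ₀ y - ((n₀ : EisensteinCoeff p m k) * ue) • y) := by
      rw [map_add, smul_add]; abel
    rw [heq]
    exact add_mem hx hy

/-! ## §2 The graded piece is a cyclic `A_{m,k}`-line -/

/-- **`W_k = A_{m,k}·(1 ⊗ Q₀) + Fil_w W_k` when `M_k = ℤ Q₀ + Fil_w M_k`**: every `x ∈ W_k` is `c • (1 ⊗ Q₀)` modulo `Fil_w W_k`
for some `c ∈ A_{m,k}` (on a pure tensor `c ⊗ a`, `a = n Q₀ + f`: `c ⊗ a = (n c) • (1 ⊗ Q₀) + c ⊗ f`).  So the graded piece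
`gr_w W_k = W_k / Fil_w W_k ≅ A_{m,k} ⊗ gr_w M_k` is a cyclic `A_{m,k}`-module.
[cite: Howard2004HeegnerKolyvagin, §3.1 (arXiv:1202.6340 p. 15 L56–62: gr_v T_𝔮 = gr_v T ⊗ S_𝔮, rank one)] -/
theorem exists_sub_smul_tmul_mem_twistedFil (k : ℕ) (Q₀ : M k) (hQ₀ : ∀ a : M k, ∃ n : ℤ, a - n • Q₀ ∈ Φ.fil k)
    (x : EisensteinCoeff.Twisted p m k (M k)) :
    ∃ c : EisensteinCoeff p m k, x - c • EisensteinCoeff.Twisted.tmul (1 : EisensteinCoeff p m k) Q₀ ∈ Φ.twistedFil k := by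
  induction x using EisensteinCoeff.Twisted.induction_on with
  | zero => exact ⟨0, by rw [zero_smul, sub_zero]; exact zero_mem _⟩
  | tmul c a =>
    obtain ⟨n, hn⟩ := hQ₀ a
    refine ⟨(n : EisensteinCoeff p m k) * c, ?_⟩
    let φ : M k →+ EisensteinCoeff.Twisted p m k (M k) :=
      { toFun := fun b ↦ EisensteinCoeff.Twisted.tmul c b
        map_zero' := TensorProduct.tmul_zero _ _
        map_add' := fun b b' ↦ TensorProduct.tmul_add _ _ _ }
    have hdecomp : a = n • Q₀ + (a - n • Q₀) := by rw [add_sub_cancel]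
    have h1 : EisensteinCoeff.Twisted.tmul (p := p) (m := m) (k := k) c a =
        ((n : EisensteinCoeff p m k) * c) • EisensteinCoeff.Twisted.tmul (1 : EisensteinCoeff p m k) Q₀ +
          EisensteinCoeff.Twisted.tmul c (a - n • Q₀) := by
      change φ a = _
      rw [hdecomp, map_add, map_zsmul, add_sub_cancel_left]
      change n • EisensteinCoeff.Twisted.tmul c Q₀ + EisensteinCoeff.Twisted.tmul c _ = _
      rw [← Int.cast_smul_eq_zsmul (EisensteinCoeff p m k) n, EisensteinCoeff.Twisted.smul_tmul,
        EisensteinCoeff.Twisted.smul_tmul, mul_one]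
    rw [h1, add_sub_cancel_left]
    exact Φ.tmul_mem_twistedFil k _ hn
  | add x y hx hy =>
    obtain ⟨c, hc⟩ := hx
    obtain ⟨d, hd⟩ := hy
    refine ⟨c + d, ?_⟩
    have heq : x + y - (c + d) • EisensteinCoeff.Twisted.tmul (1 : EisensteinCoeff p m k) Q₀ =
        (x - c • EisensteinCoeff.Twisted.tmul (1 : EisensteinCoeff p m k) Q₀) +
          (y - d • EisensteinCoeff.Twisted.tmul (1 : EisensteinCoeff p m k) Q₀) := by
      rw [add_smul]; abel
    rw [heq]
    exact add_mem hc hd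

/-! ## §3 `#{q ∈ W_k / Fil_w W_k | σ₀ q = q} ≤ #(A_{m,k} ⧸ (μ − 1))` -/

/-- **`#{q ∈ W_k / Fil_w W_k | σ₀ q = q} ≤ #(A_{m,k} ⧸ (n₀(1+T)^{κ(σ₀)} − 1))`** when `σ₀ ∈ Γ_{K_w}` acts on `M_k` as the integer `n₀`
modulo `Fil_w M_k` and `M_k = ℤ Q₀ + Fil_w M_k` (the graded line is cyclic): the fixed points of `σ₀` on the quotient
representation `(W_k|_{Γ_{K_w}}) / Fil_w W_k` are the kernel of the scalar `μ − 1`, `μ = n₀ (1+T)^{κ(σ₀)}`, on a cyclic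
`A_{m,k}`-line (`OneCocycleRestrictionKernelCountProofs.natCard_setOf_quotient_apply_eq_self_le`).
[cite: Howard2004HeegnerKolyvagin, Lemma 3.2.7 (arXiv:1202.6340 p. 16 L156–158: H⁰(K_v, gr_v ·)) and proof of Thm. 2.2.10] [cite: GreenbergLNM1716, §2 (anomalous primes)] -/
theorem natCard_setOf_quotient_twistedFil_apply_eq_self_le (k : ℕ) [Finite (M k)]
    (σ₀ : absoluteGaloisGroup (w.adicCompletion K)) (n₀ : ℤ)
    (hσ₀ : ∀ a : M k, GaloisRep.toLocal w (ρ k) σ₀ a - n₀ • a ∈ Φ.fil k)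
    (Q₀ : M k) (hQ₀ : ∀ a : M k, ∃ n : ℤ, a - n • Q₀ ∈ Φ.fil k)
    [Finite (EisensteinCoeff p m k ⧸ Ideal.span {(n₀ : EisensteinCoeff p m k) * EisensteinCoeff.onePlusT p m k ^
        κ.twistExponent (eisensteinLevel (p := p) hm k) (absGaloisRestrict K (w.adicCompletion K) σ₀) - 1})] :
    Nat.card {q : EisensteinCoeff.Twisted p m k (M k) ⧸ Φ.twistedFil k //
        (GaloisRep.toLocal w (κ.eisensteinTwist (ρ k) hm k)).quotient (Φ.twistedFil k) (Φ.twistedFil_le_comap hm k) σ₀ q = q} ≤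
      Nat.card (EisensteinCoeff p m k ⧸ Ideal.span {(n₀ : EisensteinCoeff p m k) * EisensteinCoeff.onePlusT p m k ^
        κ.twistExponent (eisensteinLevel (p := p) hm k) (absGaloisRestrict K (w.adicCompletion K) σ₀) - 1}) := by
  haveI : Finite (EisensteinCoeff.Twisted p m k (M k)) := EisensteinCoeff.finite_twisted (p := p) (k := k) hm
  exact natCard_setOf_quotient_apply_eq_self_le (S := EisensteinCoeff p m k) (Φ.twistedFil k)
    (fun a x hx ↦ Φ.smul_mem_twistedFil k a hx) (EisensteinCoeff.Twisted.tmul (1 : EisensteinCoeff p m k) Q₀)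
    (Φ.exists_sub_smul_tmul_mem_twistedFil k Q₀ hQ₀) _
    (fun x ↦ GaloisRep.toLocal w (κ.eisensteinTwist (ρ k) hm k) σ₀ x)
    (Φ.toLocal_apply_sub_smul_mem_twistedFil κ hm k σ₀ n₀ hσ₀) _
    (fun x ↦ ContinuousRep.quotient_apply_mk _ _ _ σ₀ x)

/-- The `Γ_{K_w}`-INVARIANTS of the graded piece are among the fixed points of `σ₀`: hence
`#H⁰(K_w, W_k / Fil_w W_k) ≤ #(A_{m,k} ⧸ (n₀(1+T)^{κ(σ₀)} − 1))`. [cite: Howard2004HeegnerKolyvagin, Lemma 3.2.7 and proof of Thm. 2.2.10] -/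
theorem natCard_setOf_quotient_twistedFil_forall_apply_eq_self_le (k : ℕ) [Finite (M k)]
    (σ₀ : absoluteGaloisGroup (w.adicCompletion K)) (n₀ : ℤ)
    (hσ₀ : ∀ a : M k, GaloisRep.toLocal w (ρ k) σ₀ a - n₀ • a ∈ Φ.fil k)
    (Q₀ : M k) (hQ₀ : ∀ a : M k, ∃ n : ℤ, a - n • Q₀ ∈ Φ.fil k)
    [Finite (EisensteinCoeff p m k ⧸ Ideal.span {(n₀ : EisensteinCoeff p m k) * EisensteinCoeff.onePlusT p m k ^
        κ.twistExponent (eisensteinLevel (p := p) hm k) (absGaloisRestrict K (w.adicCompletion K) σ₀) - 1})] :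
    Nat.card {q : EisensteinCoeff.Twisted p m k (M k) ⧸ Φ.twistedFil k // ∀ σ : absoluteGaloisGroup (w.adicCompletion K),
        (GaloisRep.toLocal w (κ.eisensteinTwist (ρ k) hm k)).quotient (Φ.twistedFil k) (Φ.twistedFil_le_comap hm k) σ q = q} ≤
      Nat.card (EisensteinCoeff p m k ⧸ Ideal.span {(n₀ : EisensteinCoeff p m k) * EisensteinCoeff.onePlusT p m k ^
        κ.twistExponent (eisensteinLevel (p := p) hm k) (absGaloisRestrict K (w.adicCompletion K) σ₀) - 1}) := by
  haveI : Finite (EisensteinCoeff.Twisted p m k (M k)) := EisensteinCoeff.finite_twisted (p := p) (k := k) hm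
  haveI : Finite (EisensteinCoeff.Twisted p m k (M k) ⧸ Φ.twistedFil k) :=
    Finite.of_surjective _ (Submodule.Quotient.mk_surjective _)
  calc Nat.card {q : EisensteinCoeff.Twisted p m k (M k) ⧸ Φ.twistedFil k //
          ∀ σ : absoluteGaloisGroup (w.adicCompletion K),
            (GaloisRep.toLocal w (κ.eisensteinTwist (ρ k) hm k)).quotient (Φ.twistedFil k)
              (Φ.twistedFil_le_comap hm k) σ q = q}
        ≤ Nat.card {q : EisensteinCoeff.Twisted p m k (M k) ⧸ Φ.twistedFil k //
          (GaloisRep.toLocal w (κ.eisensteinTwist (ρ k) hm k)).quotient (Φ.twistedFil k)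
            (Φ.twistedFil_le_comap hm k) σ₀ q = q} :=
        Nat.card_le_card_of_injective (fun q ↦ ⟨q.1, q.2 σ₀⟩)
          (fun x y hxy ↦ Subtype.ext (by have h := congrArg Subtype.val hxy; exact h))
    _ ≤ _ := Φ.natCard_setOf_quotient_twistedFil_apply_eq_self_le κ hm k σ₀ n₀ hσ₀ Q₀ hQ₀

/-- **`#H⁰(K_w, W_k / Fil_w W_k) ≤ p^{p^s}` UNIFORMLY in `k` and `m`**: if `σ₀ ∈ Γ_{K_w}` has `κ(σ₀) = p^s` with `p^s < m` and acts
on `M_k` modulo `Fil_w M_k` as an integer `n₀` prime to `p`, and `M_k = ℤ Q₀ + Fil_w M_k`, then the `Γ_{K_w}`-invariants of the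
graded piece `W_k / Fil_w W_k` number at most `p^{p^s}` (§3 + §4 with `(1+T)^{κ(σ₀) mod p^J} = (1+T)^{p^s}`).  Howard's correction
term `H⁰(K_v, gr_v ·)` at `𝔮 = T^m + p`, bounded independently of `m` — the anomalous case included.
[cite: Howard2004HeegnerKolyvagin, Lemma 3.2.7 (arXiv:1202.6340 p. 16 L156–158, p. 17 L14–29) and proof of Thm. 2.2.10] [cite: GreenbergLNM1716, §2–§3] -/
theorem natCard_setOf_quotient_twistedFil_forall_apply_eq_self_le_pow (k : ℕ) [Finite (M k)]
    (σ₀ : absoluteGaloisGroup (w.adicCompletion K)) (n₀ : ℤ) (hn₀ : ¬ (p : ℤ) ∣ n₀)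
    (hσ₀ : ∀ a : M k, GaloisRep.toLocal w (ρ k) σ₀ a - n₀ • a ∈ Φ.fil k)
    (Q₀ : M k) (hQ₀ : ∀ a : M k, ∃ n : ℤ, a - n • Q₀ ∈ Φ.fil k) {s : ℕ}
    (hσ : (κ (absGaloisRestrict K (w.adicCompletion K) σ₀)).toAdd = ((p ^ s : ℕ) : ℤ_[p])) (hms : p ^ s < m) :
    Nat.card {q : EisensteinCoeff.Twisted p m k (M k) ⧸ Φ.twistedFil k // ∀ σ : absoluteGaloisGroup (w.adicCompletion K),
        (GaloisRep.toLocal w (κ.eisensteinTwist (ρ k) hm k)).quotient (Φ.twistedFil k) (Φ.twistedFil_le_comap hm k) σ q = q} ≤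
      p ^ (p ^ s) := by
  have hpow := κ.onePlusT_pow_twistExponent_eq_of_toAdd_eq_natCast hm k hσ
  obtain ⟨hfin, hle⟩ := EisensteinCoeff.natCard_quotient_span_intCast_mul_onePlusT_pow_sub_one_le p hm k hn₀ hms
  rw [← hpow] at hfin hle
  haveI := hfin
  exact (Φ.natCard_setOf_quotient_twistedFil_forall_apply_eq_self_le κ hm k σ₀ n₀ hσ₀ Q₀ hQ₀).trans hle

/-! ## §5 The count of local classes of the graded piece dying over `K_{∞,w}` -/

omit [NumberField K] in
/-- Membership in the kernel of `κ ∘ res : Γ_{K_w} → ℤ_p` is membership of the restriction in `ker κ = Gal(K̄/K_∞)`.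
[cite: GreenbergLNM1716, §3 (the decomposition group of w in Γ = Gal(K_∞/K))] -/
theorem mem_ker_comp_absGaloisRestrict_iff (F : Type) [Field F] [Algebra K F] (σ : absoluteGaloisGroup F) :
    σ ∈ (κ.toContinuousMonoidHom.comp (absGaloisRestrict K F)).toMonoidHom.ker ↔
      absGaloisRestrict K F σ ∈ κ.kerSubgroup :=
  Iff.rfl

/-- **The local classes of the graded piece `W_k / Fil_w W_k` that die over `K_{∞,w}` number at most `p^{p^s}`, uniformly in
`k` and `m`.**  With `S = {σ ∈ Γ_{K_w} | res σ ∈ ker κ} = Gal(K̄_w/K_{∞,w})`: the classes `x ∈ H¹(K_w, W_k / Fil_w W_k)` having a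
representative cocycle that is PRINCIPAL ON `S` form a finite set of order `≤ p^{p^s}`, provided `σ₀ ∈ Γ_{K_w}` with `κ(σ₀) = p^s`,
`p^s < m`, acts on `M_k` modulo `Fil_w M_k` as an integer `n₀` prime to `p` and `M_k = ℤ Q₀ + Fil_w M_k`
(`OneCocycleRestrictionKernelCountProofs`: `#ker(res) ≤ #H⁰` for the dense `⟨S, g₀⟩` supplied by
`exists_dense_closure_ker_union_singleton`, then §3).  This is the graded half of the `m`-UNIFORM local defect at `w ∣ p` in
the index clause (B5) of Howard's readout (blueprint S1-DISCRETE §2 «v ∣ p»).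
[cite: Howard2004HeegnerKolyvagin, Prop. 2.2.8 and proof of Thm. 2.2.10 (𝔮 = T^m + p), Lemma 3.2.7] [cite: GreenbergLNM1716, §3 (local kernels H¹(K_v, ·) → H¹(K_{∞,w}, ·))] -/
theorem finite_and_natCard_setOf_oneCocycleClass_quotient_twistedFil_principal_le_pow (k : ℕ) [Finite (M k)]
    (σ₀ : absoluteGaloisGroup (w.adicCompletion K)) (n₀ : ℤ) (hn₀ : ¬ (p : ℤ) ∣ n₀)
    (hσ₀ : ∀ a : M k, GaloisRep.toLocal w (ρ k) σ₀ a - n₀ • a ∈ Φ.fil k)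
    (Q₀ : M k) (hQ₀ : ∀ a : M k, ∃ n : ℤ, a - n • Q₀ ∈ Φ.fil k) {s : ℕ}
    (hσ : (κ (absGaloisRestrict K (w.adicCompletion K) σ₀)).toAdd = ((p ^ s : ℕ) : ℤ_[p])) (hms : p ^ s < m) :
    Finite {x : galoisCohomology ((GaloisRep.toLocal w (κ.eisensteinTwist (ρ k) hm k)).quotient (Φ.twistedFil k)
        (Φ.twistedFil_le_comap hm k)) 1 //
        ∃ φ : contOneCocycles ((GaloisRep.toLocal w (κ.eisensteinTwist (ρ k) hm k)).quotient (Φ.twistedFil k)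
            (Φ.twistedFil_le_comap hm k)).toTopRep,
          oneCocycleClass _ φ = x ∧ ∃ v : EisensteinCoeff.Twisted p m k (M k) ⧸ Φ.twistedFil k,
            ∀ σ : absoluteGaloisGroup (w.adicCompletion K), absGaloisRestrict K (w.adicCompletion K) σ ∈ κ.kerSubgroup →
              φ.1 σ = (GaloisRep.toLocal w (κ.eisensteinTwist (ρ k) hm k)).quotient (Φ.twistedFil k)
                (Φ.twistedFil_le_comap hm k) σ v - v} ∧
      Nat.card {x : galoisCohomology ((GaloisRep.toLocal w (κ.eisensteinTwist (ρ k) hm k)).quotient (Φ.twistedFil k)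
          (Φ.twistedFil_le_comap hm k)) 1 //
          ∃ φ : contOneCocycles ((GaloisRep.toLocal w (κ.eisensteinTwist (ρ k) hm k)).quotient (Φ.twistedFil k)
              (Φ.twistedFil_le_comap hm k)).toTopRep,
            oneCocycleClass _ φ = x ∧ ∃ v : EisensteinCoeff.Twisted p m k (M k) ⧸ Φ.twistedFil k,
              ∀ σ : absoluteGaloisGroup (w.adicCompletion K), absGaloisRestrict K (w.adicCompletion K) σ ∈ κ.kerSubgroup →
                φ.1 σ = (GaloisRep.toLocal w (κ.eisensteinTwist (ρ k) hm k)).quotient (Φ.twistedFil k)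
                  (Φ.twistedFil_le_comap hm k) σ v - v} ≤ p ^ (p ^ s) := by
  haveI : Finite (EisensteinCoeff.Twisted p m k (M k)) := EisensteinCoeff.finite_twisted (p := p) (k := k) hm
  haveI hfinQ : Finite (EisensteinCoeff.Twisted p m k (M k) ⧸ Φ.twistedFil k) :=
    Finite.of_surjective _ (Submodule.Quotient.mk_surjective _)
  haveI := absoluteGaloisGroup_compactSpace (w.adicCompletion K)
  -- the quotient representation as an object of `TopRep`
  set X : TopRep ℤ (absoluteGaloisGroup (w.adicCompletion K)) :=
    ((GaloisRep.toLocal w (κ.eisensteinTwist (ρ k) hm k)).quotient (Φ.twistedFil k) (Φ.twistedFil_le_comap hm k)).toTopRep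
    with hXdef
  haveI hXfin : Finite X := hfinQ
  -- the dense co-generator `g₀` of `Γ_{K_w}` over `S = res⁻¹(ker κ)`
  have hg := exists_dense_closure_ker_union_singleton
    (κ.toContinuousMonoidHom.comp (absGaloisRestrict K (w.adicCompletion K)))
  obtain ⟨g₀, hnorm, hdense⟩ := hg
  have hX : ∀ v : X, Continuous fun g : absoluteGaloisGroup (w.adicCompletion K) ↦ X.ρ g v := fun v ↦
    ((GaloisRep.toLocal w (κ.eisensteinTwist (ρ k) hm k)).quotient (Φ.twistedFil k)
      (Φ.twistedFil_le_comap hm k)).continuous_apply_left v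
  have hmain := finite_and_natCard_setOf_oneCocycleClass_restrict_eq_zero_le (X := X) hX
    (κ.toContinuousMonoidHom.comp (absGaloisRestrict K (w.adicCompletion K))).toMonoidHom.ker g₀ hnorm hdense
  obtain ⟨hfin, hle⟩ := hmain
  refine ⟨hfin, hle.trans ?_⟩
  exact Φ.natCard_setOf_quotient_twistedFil_forall_apply_eq_self_le_pow κ hm k σ₀ n₀ hn₀ hσ₀ Q₀ hQ₀ hσ hms

end OrdinaryFiltration

end ZpExtension


/-! ## §6 Discharging the scalar hypotheses from an adapted coordinate; the `E[p^k]`-instance -/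

section Coordinate

variable {N : Type*} [AddCommGroup N] {q : ℕ} [NeZero q]

/-- Any additive map to `ℤ/q` vanishing on the kernel of a coordinate `π : N → ℤ/q` with `π Q₀ = 1` is a MULTIPLE of `π`:
`ψ a = π a · ψ Q₀` (`a − (π a) Q₀ ∈ ker π`). [cite: Howard2004HeegnerKolyvagin, §3.1 (arXiv:1202.6340 p. 15 L56–62: gr_v T is a rank-one quotient)] -/
theorem apply_eq_apply_mul_of_forall_ker (π ψ : N →+ ZMod q) (Q₀ : N) (hQ₀ : π Q₀ = 1)
    (hψ : ∀ a, π a = 0 → ψ a = 0) (a : N) : ψ a = π a * ψ Q₀ := by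
  have hker : π (a - (π a).val • Q₀) = 0 := by
    rw [map_sub, map_nsmul, hQ₀, nsmul_eq_mul, mul_one, ZMod.natCast_zmod_val, sub_self]
  have h := hψ _ hker
  rw [map_sub, map_nsmul, sub_eq_zero] at h
  rw [h, nsmul_eq_mul, ZMod.natCast_zmod_val]

/-- Every element is an integer multiple of `Q₀` modulo `ker π`. [cite: Howard2004HeegnerKolyvagin, §3.1] -/
theorem exists_sub_zsmul_mem_ker (π : N →+ ZMod q) (Q₀ : N) (hQ₀ : π Q₀ = 1) (a : N) :
    ∃ n : ℤ, π (a - n • Q₀) = 0 :=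
  ⟨(π a).val, by rw [map_sub, natCast_zsmul, map_nsmul, hQ₀, nsmul_eq_mul, mul_one, ZMod.natCast_zmod_val,
    sub_self]⟩

/-- **An automorphism preserving `ker π` acts as an integer `n₀` PRIME TO `p` modulo `ker π`** (`q = p^k`, `k ≥ 1`): with
`c = π (g Q₀)`, `π ∘ g = c · π`, and `c` is a unit because `g` has an inverse `g'` also preserving `ker π`.
[cite: Howard2004HeegnerKolyvagin, §3.1 and Lemma 3.2.7 (the scalar of Frobenius / inertia on gr_v)] [cite: GreenbergLNM1716, §2 (anomalous primes: the action on Ẽ[p])] -/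
theorem exists_int_not_dvd_forall_apply_sub_zsmul {p k : ℕ} [hp : Fact p.Prime] (hk : 1 ≤ k) (π : N →+ ZMod (p ^ k))
    (Q₀ : N) (hQ₀ : π Q₀ = 1) (g g' : N →+ N) (hgg' : ∀ a, g (g' a) = a)
    (hg : ∀ a, π a = 0 → π (g a) = 0) (hg' : ∀ a, π a = 0 → π (g' a) = 0) :
    ∃ n₀ : ℤ, ¬ (p : ℤ) ∣ n₀ ∧ ∀ a, π (g a - n₀ • a) = 0 := by
  haveI : NeZero (p ^ k) := ⟨pow_ne_zero _ hp.out.ne_zero⟩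
  set c : ZMod (p ^ k) := π (g Q₀) with hc
  set c' : ZMod (p ^ k) := π (g' Q₀) with hc'
  have hψ : ∀ a, π (g a) = π a * c := fun a ↦
    apply_eq_apply_mul_of_forall_ker π (π.comp g) Q₀ hQ₀ (fun a ha ↦ hg a ha) a
  have hψ' : ∀ a, π (g' a) = π a * c' := fun a ↦
    apply_eq_apply_mul_of_forall_ker π (π.comp g') Q₀ hQ₀ (fun a ha ↦ hg' a ha) a
  have hunit : IsUnit c := by
    have h1 : (1 : ZMod (p ^ k)) = c' * c := by
      rw [← hQ₀, ← hgg' Q₀]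
      conv_lhs => rw [hψ, hψ', hQ₀, one_mul]
    exact IsUnit.of_mul_eq_one_right c' h1.symm
  refine ⟨(c.val : ℤ), fun hdvd ↦ ?_, fun a ↦ ?_⟩
  · have hcop : c.val.Coprime (p ^ k) := by
      rw [← ZMod.isUnit_iff_coprime, ZMod.natCast_zmod_val]; exact hunit
    have hpc : p ∣ c.val := by exact_mod_cast hdvd
    have hpp : p.Coprime p := (Nat.coprime_pow_right_iff hk _ _).1 (Nat.Coprime.coprime_dvd_left hpc hcop)
    exact (Nat.coprime_self p).not.2 hp.out.one_lt.ne' hpp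
  · rw [map_sub, natCast_zsmul, map_nsmul, hψ, nsmul_eq_mul, ZMod.natCast_zmod_val, mul_comm, sub_self]

end Coordinate


end Literature.NumberTheory.EllipticCurves

/-! ## §7 The `E[p^k]`-instance at a place `v ∣ p` of good reduction with an ordinary point -/

namespace WeierstrassCurve

open Literature.NumberTheory.EllipticCurves Literature.NumberTheory.GaloisRepresentations
  IwasawaAlgebra IwasawaAlgebra.EisensteinCoeff

variable {K : Type} [Field K] [NumberField K] (V : WeierstrassCurve K) [V.IsElliptic] {p : ℕ} [hp : Fact p.Prime]
  (κ : ZpExtension K p) {m : ℕ} (hm : 1 ≤ m) (v : HeightOneSpectrum (𝓞 K))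
  (t : ∀ k, (V.torsionGaloisModule ((p : ℤ) ^ (k + 1))).toContRepresentation →ⁱL
    (V.torsionGaloisModule ((p : ℤ) ^ k)).toContRepresentation)
  (ht : ∀ k (P : geomTorsion V ((p : ℤ) ^ (k + 1))), t k P = V.geomTorsionReduce p k P)

/-- **Every `σ₀ ∈ Γ_{K_v}` acts on `gr_v E[p^k] = E[p^k] / Fil_v E[p^k]` as an integer `n₀` prime to `p`, and `E[p^k] = ℤ Q₀ + Fil_v E[p^k]`**
(`k ≥ 1`, `v ∋ p` of good reduction with an ordinary point): from the adapted basis `e : E[p^k] ≃ (ℤ/p^k)²`, `Fil_v = {e(·)₁ = 0}`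
(`exists_addEquiv_mem_torsionFilAt_iff`) with the coordinate `π = e(·)₁` and `Q₀ = e⁻¹(0,1)`.
[cite: Howard2004HeegnerKolyvagin, §3.1 (arXiv:1202.6340 p. 15 L56–62) and Lemma 3.2.7] [cite: GreenbergLNM1716, §2 (the action on Ẽ[p^k])] -/
theorem exists_int_scalar_torsionFilAt (hgood : V.HasGoodReductionAt v) (hpv : (p : 𝓞 K) ∈ v.asIdeal)
    (hord : ∃ P : localPoints V (v.adicCompletion K), (p : ℤ) • P = 0 ∧ P ∉ V.localKernelOfReduction v) {k : ℕ}
    (hk : 1 ≤ k) (σ₀ : absoluteGaloisGroup (v.adicCompletion K)) :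
    ∃ (n₀ : ℤ) (Q₀ : geomTorsion V ((p : ℤ) ^ k)), ¬ (p : ℤ) ∣ n₀ ∧
      (∀ a, GaloisRep.toLocal v (V.torsionGaloisModule ((p : ℤ) ^ k)) σ₀ a - n₀ • a ∈ V.torsionFilAt v ((p : ℤ) ^ k)) ∧
      (∀ a, ∃ n : ℤ, a - n • Q₀ ∈ V.torsionFilAt v ((p : ℤ) ^ k)) := by
  haveI : NeZero (p ^ k) := ⟨pow_ne_zero k hp.out.ne_zero⟩
  obtain ⟨e, he⟩ := V.exists_addEquiv_mem_torsionFilAt_iff v hgood hpv hord hk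
  -- the coordinate `π = e(·)₁`, its section `Q₀`
  let π : geomTorsion V ((p : ℤ) ^ k) →+ ZMod (p ^ k) :=
    (Pi.evalAddMonoidHom (fun _ : Fin 2 ↦ ZMod (p ^ k)) 1).comp e.toAddMonoidHom
  have hπ : ∀ a, π a = e a 1 := fun _ ↦ rfl
  have hmem : ∀ a, a ∈ V.torsionFilAt v ((p : ℤ) ^ k) ↔ π a = 0 := fun a ↦ by rw [hπ]; exact he a
  let Q₀ : geomTorsion V ((p : ℤ) ^ k) := e.symm (Pi.single 1 1)
  have hQ₀ : π Q₀ = 1 := by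
    rw [hπ]
    change e (e.symm (Pi.single 1 1)) 1 = 1
    rw [AddEquiv.apply_symm_apply, Pi.single_eq_same]
  -- `σ₀` and `σ₀⁻¹` preserve `Fil_v`
  let g : geomTorsion V ((p : ℤ) ^ k) →+ geomTorsion V ((p : ℤ) ^ k) :=
    (GaloisRep.toLocal v (V.torsionGaloisModule ((p : ℤ) ^ k)) σ₀).toAddMonoidHom
  let g' : geomTorsion V ((p : ℤ) ^ k) →+ geomTorsion V ((p : ℤ) ^ k) :=
    (GaloisRep.toLocal v (V.torsionGaloisModule ((p : ℤ) ^ k)) σ₀⁻¹).toAddMonoidHom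
  have hg : ∀ a, g a = GaloisRep.toLocal v (V.torsionGaloisModule ((p : ℤ) ^ k)) σ₀ a := fun _ ↦ rfl
  have hg' : ∀ a, g' a = GaloisRep.toLocal v (V.torsionGaloisModule ((p : ℤ) ^ k)) σ₀⁻¹ a := fun _ ↦ rfl
  have hgg' : ∀ a, g (g' a) = a := fun a ↦ by
    rw [hg, hg']
    change (GaloisRep.toLocal v (V.torsionGaloisModule ((p : ℤ) ^ k)) σ₀ *
      GaloisRep.toLocal v (V.torsionGaloisModule ((p : ℤ) ^ k)) σ₀⁻¹) a = a
    rw [← map_mul, mul_inv_cancel, map_one]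
    rfl
  have hgFil : ∀ a, π a = 0 → π (g a) = 0 := fun a ha ↦
    (hmem _).1 (by rw [hg]; exact V.smul_mem_torsionFilAt v _ σ₀ a ((hmem a).2 ha))
  have hg'Fil : ∀ a, π a = 0 → π (g' a) = 0 := fun a ha ↦
    (hmem _).1 (by rw [hg']; exact V.smul_mem_torsionFilAt v _ σ₀⁻¹ a ((hmem a).2 ha))
  obtain ⟨n₀, hn₀, hσ₀⟩ := exists_int_not_dvd_forall_apply_sub_zsmul hk π Q₀ hQ₀ g g' hgg' hgFil hg'Fil
  refine ⟨n₀, Q₀, hn₀, fun a ↦ (hmem _).2 (by rw [← hg]; exact hσ₀ a), fun a ↦ ?_⟩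
  obtain ⟨n, hn⟩ := exists_sub_zsmul_mem_ker π Q₀ hQ₀ a
  exact ⟨n, (hmem _).2 hn⟩

/-- **The `m`-UNIFORM local count at `v ∣ p` for the curve.**  At a place `v ∋ p` of good reduction with an ordinary point, for the
Eisenstein level `T = E[p^k] ⊗ A_{m,k}(ψ)` (`k ≥ 1`) with its ordinary filtration `Fil_v T = A_{m,k} ⊗ Fil_v E[p^k]` and any
`σ₀ ∈ Γ_{K_v}` with `κ(σ₀) = p^s`, `p^s < m`: the classes of `H¹(K_v, T / Fil_v T)` that are PRINCIPAL ON
`Gal(K̄_v/K_{∞,w}) = {σ | res σ ∈ ker κ}` form a finite set of order `≤ p^{p^s}` — independently of `k` and `m`.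
(§5 with §7's scalar data.)  This bounds the graded half of the local defect at `v ∣ p` in the index clause (B5) of
Howard's readout at `𝔮 = T^m + p` (blueprint S1-DISCRETE §2, shared μ-crux stmt-BirchSwinnertonDyer-23428).
[cite: Howard2004HeegnerKolyvagin, Prop. 2.2.8, Lemma 3.2.7 and proof of Thm. 2.2.10 (arXiv:1202.6340 p. 16–18)] [cite: GreenbergLNM1716, §2–§3] -/
theorem finite_and_natCard_setOf_oneCocycleClass_quotient_torsionFilAt_principal_le_pow
    (hgood : V.HasGoodReductionAt v) (hpv : (p : 𝓞 K) ∈ v.asIdeal)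
    (hord : ∃ P : localPoints V (v.adicCompletion K), (p : ℤ) • P = 0 ∧ P ∉ V.localKernelOfReduction v) {k : ℕ}
    (hk : 1 ≤ k) (σ₀ : absoluteGaloisGroup (v.adicCompletion K)) {s : ℕ}
    (hσ : (κ (absGaloisRestrict K (v.adicCompletion K) σ₀)).toAdd = ((p ^ s : ℕ) : ℤ_[p])) (hms : p ^ s < m) :
    Finite {x : galoisCohomology ((GaloisRep.toLocal v (κ.eisensteinTwist (V.torsionGaloisModule ((p : ℤ) ^ k)) hm k)).quotient
        ((V.ordinaryFiltrationAt v t ht).twistedFil k) ((V.ordinaryFiltrationAt v t ht).twistedFil_le_comap hm k)) 1 //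
        ∃ φ : contOneCocycles ((GaloisRep.toLocal v (κ.eisensteinTwist (V.torsionGaloisModule ((p : ℤ) ^ k)) hm k)).quotient
            ((V.ordinaryFiltrationAt v t ht).twistedFil k) ((V.ordinaryFiltrationAt v t ht).twistedFil_le_comap hm k)).toTopRep,
          oneCocycleClass _ φ = x ∧
            ∃ q₀ : EisensteinCoeff.Twisted p m k (geomTorsion V ((p : ℤ) ^ k)) ⧸ (V.ordinaryFiltrationAt v t ht).twistedFil k,
              ∀ σ : absoluteGaloisGroup (v.adicCompletion K), absGaloisRestrict K (v.adicCompletion K) σ ∈ κ.kerSubgroup →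
                φ.1 σ = (GaloisRep.toLocal v (κ.eisensteinTwist (V.torsionGaloisModule ((p : ℤ) ^ k)) hm k)).quotient
                  ((V.ordinaryFiltrationAt v t ht).twistedFil k) ((V.ordinaryFiltrationAt v t ht).twistedFil_le_comap hm k)
                  σ q₀ - q₀} ∧
      Nat.card {x : galoisCohomology ((GaloisRep.toLocal v (κ.eisensteinTwist (V.torsionGaloisModule ((p : ℤ) ^ k)) hm k)).quotient
          ((V.ordinaryFiltrationAt v t ht).twistedFil k) ((V.ordinaryFiltrationAt v t ht).twistedFil_le_comap hm k)) 1 //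
          ∃ φ : contOneCocycles ((GaloisRep.toLocal v (κ.eisensteinTwist (V.torsionGaloisModule ((p : ℤ) ^ k)) hm k)).quotient
              ((V.ordinaryFiltrationAt v t ht).twistedFil k) ((V.ordinaryFiltrationAt v t ht).twistedFil_le_comap hm k)).toTopRep,
            oneCocycleClass _ φ = x ∧
              ∃ q₀ : EisensteinCoeff.Twisted p m k (geomTorsion V ((p : ℤ) ^ k)) ⧸ (V.ordinaryFiltrationAt v t ht).twistedFil k,
                ∀ σ : absoluteGaloisGroup (v.adicCompletion K), absGaloisRestrict K (v.adicCompletion K) σ ∈ κ.kerSubgroup →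
                  φ.1 σ = (GaloisRep.toLocal v (κ.eisensteinTwist (V.torsionGaloisModule ((p : ℤ) ^ k)) hm k)).quotient
                    ((V.ordinaryFiltrationAt v t ht).twistedFil k) ((V.ordinaryFiltrationAt v t ht).twistedFil_le_comap hm k)
                    σ q₀ - q₀} ≤ p ^ (p ^ s) := by
  haveI : NeZero (p ^ k) := ⟨pow_ne_zero k hp.out.ne_zero⟩
  haveI : Finite (geomTorsion V ((p : ℤ) ^ k)) :=
    finite_torsionPoints_holds V (AlgebraicClosure K) (pow_ne_zero k (Nat.cast_ne_zero.mpr hp.out.ne_zero))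
  have hdata := V.exists_int_scalar_torsionFilAt v hgood hpv hord hk σ₀
  obtain ⟨n₀, Q₀, hn₀, hσ₀, hQ₀⟩ := hdata
  have hmain := (V.ordinaryFiltrationAt v t ht).finite_and_natCard_setOf_oneCocycleClass_quotient_twistedFil_principal_le_pow
    κ hm k σ₀ n₀ hn₀ hσ₀ Q₀ hQ₀ hσ hms
  exact hmain

end WeierstrassCurve
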